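import Literature.NumberTheory.Automorphic.LieAlgebraGLDiagonal
import Literature.NumberTheory.Automorphic.RightTranslationGL
import Literature.NumberTheory.Automorphic.WeightTorus
import Literature.NumberTheory.Automorphic.TorusRigidity
import Literature.NumberTheory.Automorphic.ZariskiGLGeneration
import Literature.NumberTheory.Automorphic.LieAlgebraWeights
import HarnessLib

/-!
# The algebraic hull of a semisimple element of `Lie(G)` (Chevalley); semisimple elements of
`𝔤^T` lie in `Lie(T)` (trunk T-AUTOMORPHIC, G25 AutomorphicL)

Companion to `LieAlgebraGLDerivation.lean` (the invariant derivations `D_X` of `k[x_{ij}, y]`,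
`Lie(G) = {X | D_X 𝓘(G) ⊆ 𝓘(G)}`, the monomial eigenvectors of `D_{diag(s)}`),
`LieAlgebraGLDiagonal.lean` (`diag(v) ∈ Lie(T)` for `T ≤ 𝔻ₙ` from the character relations),
`RightTranslationGL.lean` (right translations `rTransGL`, `G` is the stabiliser of `𝓘(G)`,
Springer 2.3.6; monomials are eigenvectors of `ρ(diag d)`), `WeightTorus.lean` (the torus with a
prescribed free character group) and `TorusCharacters.lean` (simultaneous diagonalisation),
namespace `Literature.NumberTheory.Automorphic`, concrete `k`-points vocabulary. This is the
semisimple half of the characteristic-zero correspondence between `Lie(G)` and `G` (the nilpotent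
half is the exponential, `LieAlgebraGLExp.lean`). Everything is proved:

* `mem_of_sum_eigenvector_mem` — eigen-components of a vector of a stable subspace lie in it;
* `wvec m`, `sum_rDerivWeight_eq_zdot`, `prod_diagWeightGL_eq_prod_zpow` — a monomial `m` of
  `k[x_{ij}, y]` has `D_{diag(s)}`-eigenvalue `⟨w(m), s⟩` and `ρ(diag d)`-eigenvalue `d^{w(m)}`
  for one exponent vector `w(m) ∈ ℤⁿ`;
* `hullLattice s = Λ_s = {a ∈ ℤⁿ | ⟨a, s⟩ = 0}` and the **hull torus**
  `hullTorus s = T_s = {diag(d) | d^a = 1, a ∈ Λ_s}` (a `weightTorus` with character group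
  `ℤⁿ / Λ_s`, free in characteristic `0`), a torus (`isTorusSubgroup_hullTorus`) whose characters
  detect `Λ_s` (`zdot_eq_zero_of_forall_mem_hullTorus`);
* **`hullTorus_le_of_diagonal_mem_lieAlgebraGL`** (Chevalley): if `G` is algebraic and
  `diag(s) ∈ Lie(G)` then `T_s ≤ G` — `𝓘(G)` is `D_{diag(s)}`-stable, hence the sum of its
  eigen-class parts (`classPart`, `classPart_mem_of_mem`), on each of which `ρ(t)`, `t ∈ T_s`, is
  a scalar (`rTransGL_classPart`), so `ρ(t) 𝓘(G) ⊆ 𝓘(G)` and `t ∈ G` (Springer 2.3.6);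
* **`diagonal_mem_lieAlgebraGL_of_isMaximalTorusIn`**,
  **`mem_lieAlgebraGL_of_isMaximalTorusIn_of_isSemisimple`** — over an algebraically closed field
  of characteristic `0`: if `T` is a maximal torus of the algebraic group `G` and `S ∈ Lie(G)` is a
  semisimple matrix commuting with `T`, then `S ∈ Lie(T)`. (After simultaneous diagonalisation of
  `T` and `S`: `T · T_s` is a torus of `G` containing `T`, so `T_s ≤ T` by maximality, so every
  character trivial on `T` has exponent in `Λ_s`, so `diag(s) ∈ Lie(T)` by
  `diagonal_mem_lieAlgebraGL_of_forall_diagChar`.) This is the semisimple part of the statement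
  `𝔤^T = Lie(T)` (Springer 5.4.7 with 7.6.4 (ii) for reductive `G`; here for any algebraic `G`,
  on semisimple elements, in characteristic `0`).

Also: `conj_mem_lieAlgebraGL_map_conj` (`Lie(g H g⁻¹) = g Lie(H) g⁻¹`, Springer 4.4.5 (ii)),
`isSemisimpleElt_of_mem_closure`, `exists_conj_diagonal_of_isSemisimple`.

## Mathlib

`Subgroup.isMulCommutative_closure`, `Module.End.IsSemisimple.mul_of_commute`,
`Module.End.isSemisimple_sub_algebraMap_iff`, `Module.free_of_finite_type_torsion_free'`,
`QuotientAddGroup`, `Matrix.eval_charpoly`. Mathlib has no algebraic groups, tori or algebraic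
hulls; nothing here duplicates a Mathlib or Literature declaration (searched `hull`, `weightTorus`,
`zdot`, `classPart`).

## References

* C. Chevalley, *Théorie des groupes de Lie II: Groupes algébriques*, Hermann (1951), Ch. II
  §§13–14 (groupes algébriques engendrés, répliques).
* A. Borel, *Linear Algebraic Groups*, 2nd ed., GTM 126, Springer (1991), Chapter II §7
  (characteristic `0`: the groups `𝒜(M)`).
* T. A. Springer, *Linear Algebraic Groups*, 2nd ed., Progress in Mathematics 9, Birkhäuser
  (1998), 2.3.6, 3.2.10 (4), 4.4.5 (ii), 5.4.7, 7.6.4 (ii) [SpringerLAG1998].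
-/

noncomputable section

open MvPolynomial

namespace Literature.NumberTheory.Automorphic

variable {k : Type*} [Field k] {n : Type*} [Fintype n] [DecidableEq n]

/-! ### Eigenvectors of an operator in a stable subspace -/

section Vandermonde

variable {V : Type*} [AddCommGroup V] [Module k V]

/-- **Components of a vector in a stable subspace.** Let `L` be a linear operator, `W` an
`L`-stable subspace, and `v μ` (`μ ∈ F`, a finite set of scalars) vectors with `L (v μ) = μ v μ`.
If `∑_{μ ∈ F} v μ ∈ W` then every `v μ ∈ W` (apply the operators `L - μ₀` and induct; a
Vandermonde argument). [folklore] -/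
theorem mem_of_sum_eigenvector_mem (L : V →ₗ[k] V) {W : Submodule k V}
    (hW : ∀ x ∈ W, L x ∈ W) (F : Finset k) :
    ∀ v : k → V, (∀ μ ∈ F, L (v μ) = μ • v μ) → ∑ μ ∈ F, v μ ∈ W → ∀ μ ∈ F, v μ ∈ W := by
  classical
  induction F using Finset.induction_on with
  | empty => intro v _ _ μ hμ; exact absurd hμ (Finset.notMem_empty μ)
  | insert μ₀ F hμ₀ ih =>
    intro v hv hsum
    rw [Finset.sum_insert hμ₀] at hsum
    -- apply `L - μ₀` to the sum
    have h1 : ∑ μ ∈ F, (μ - μ₀) • v μ ∈ W := by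
      have h := W.sub_mem (hW _ hsum) (W.smul_mem μ₀ hsum)
      rw [map_add, hv μ₀ (Finset.mem_insert_self μ₀ F), map_sum, smul_add, Finset.smul_sum,
        add_sub_add_comm, sub_self, zero_add, ← Finset.sum_sub_distrib] at h
      convert h using 1
      refine Finset.sum_congr rfl fun μ hμ => ?_
      rw [hv μ (Finset.mem_insert_of_mem hμ), sub_smul]
    have h2 := ih (fun μ => (μ - μ₀) • v μ)
      (fun μ hμ => by rw [map_smul, hv μ (Finset.mem_insert_of_mem hμ), smul_comm]) h1
    have h3 : ∀ μ ∈ F, v μ ∈ W := by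
      intro μ hμ
      have hne : μ - μ₀ ≠ 0 := sub_ne_zero.2 (fun h => hμ₀ (h ▸ hμ))
      have h := W.smul_mem (μ - μ₀)⁻¹ (h2 μ hμ)
      rwa [smul_smul, inv_mul_cancel₀ hne, one_smul] at h
    intro μ hμ
    rcases Finset.mem_insert.1 hμ with rfl | hμ
    · have h := W.sub_mem hsum (W.sum_mem fun μ hμ => h3 μ hμ)
      rwa [add_sub_cancel_right] at h
    · exact h3 μ hμ

end Vandermonde

/-! ### The weights of the monomials under `D_{diag(s)}` and under right translations -/

section MonomialWeights

/-- The exponent vector `w(m) ∈ ℤⁿ` of a monomial `m` of `k[x_{ij}, y]` restricted to the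
diagonal: `w(m)_j = ∑ᵢ m_{ij} - m_y` (column sums minus the exponent of `y = det⁻¹`), so that the
monomial is `t ↦ t^{w(m)}`-homogeneous under right translation by `t ∈ 𝔻ₙ`. [folklore] -/
def wvec (m : GLCoord n →₀ ℕ) : n → ℤ :=
  fun j => (∑ i, (m (Sum.inl (i, j)) : ℤ)) - m (Sum.inr ())

omit [DecidableEq n] in
/-- The eigenvalue of the monomial `m` under `D_{diag(s)}` is `⟨w(m), s⟩`. [folklore] -/
lemma sum_rDerivWeight_eq_zdot (s : n → k) (m : GLCoord n →₀ ℕ) :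
    (m.sum fun c e => (e : k) * rDerivWeight s c) = zdot (wvec m) s := by
  rw [Finsupp.sum_fintype _ _ (fun c => by simp), Fintype.sum_sum_type, Fintype.sum_prod_type]
  have hU : ∑ u : Unit, ((m (Sum.inr u) : ℕ) : k) * rDerivWeight s (Sum.inr u) =
      (m (Sum.inr ()) : k) * (-∑ i, s i) := by
    rw [Fintype.sum_unique]; rfl
  rw [hU, zdot]
  simp only [rDerivWeight, wvec, Int.cast_sub, Int.cast_sum, Int.cast_natCast, sub_mul,
    Finset.sum_mul, Finset.sum_sub_distrib, mul_neg, Finset.mul_sum, ← Finset.sum_neg_distrib]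
  rw [Finset.sum_comm, sub_eq_add_neg, ← Finset.sum_neg_distrib]

omit [DecidableEq n] in
/-- The eigenvalue of the monomial `m` under right translation by `diag(d)` is `d^{w(m)}`.
[folklore] -/
lemma prod_diagWeightGL_eq_prod_zpow (d : n → kˣ) (m : GLCoord n →₀ ℕ) :
    (m.prod fun c e => diagWeightGL d c ^ e) = ((∏ j, d j ^ wvec m j : kˣ) : k) := by
  rw [Finsupp.prod_fintype _ _ (fun c => by simp), Fintype.prod_sum_type, Fintype.prod_prod_type]
  have hU : ∏ u : Unit, diagWeightGL d (Sum.inr u) ^ m (Sum.inr u) =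
      ((∏ i, (d i : k))⁻¹) ^ m (Sum.inr ()) := by
    rw [Fintype.prod_unique]; rfl
  rw [hU, Units.coe_prod, Finset.prod_comm]
  have hR : ∀ j, (((d j ^ wvec m j : kˣ)) : k) =
      (d j : k) ^ (∑ i, m (Sum.inl (i, j))) * ((d j : k) ^ m (Sum.inr ()))⁻¹ := by
    intro j
    rw [Units.val_zpow_eq_zpow_val, wvec, zpow_sub₀ (d j).ne_zero, ← Nat.cast_sum, zpow_natCast,
      zpow_natCast, div_eq_mul_inv]
  simp only [hR, diagWeightGL, Finset.prod_mul_distrib, Finset.prod_inv_distrib, inv_pow,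
    Finset.prod_pow, Finset.prod_pow_eq_pow_sum]

end MonomialWeights

/-! ### The hull torus `T_s` of a diagonal matrix `diag(s)` -/

section HullTorus

variable (s : n → k)

/-- The pairing `a ↦ ⟨a, s⟩` as an additive homomorphism `ℤⁿ → k`. [folklore] -/
def zdotHom : (n → ℤ) →+ k where
  toFun a := zdot a s
  map_zero' := zdot_zero s
  map_add' a b := zdot_add a b s

omit [DecidableEq n] in
/-- Unfolding `zdotHom`. [folklore] -/
@[simp] lemma zdotHom_apply (a : n → ℤ) : zdotHom s a = zdot a s := rfl

omit [DecidableEq n] in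
/-- The **hull lattice** `Λ_s = {a ∈ ℤⁿ | ⟨a, s⟩ = ∑ aᵢ sᵢ = 0}` of `s ∈ kⁿ`: the exponents of the
monomial characters of `𝔻ₙ` killed by the tangent vector `diag(s)` (Chevalley's algebraic hull
of a semisimple element; Borel, *Linear Algebraic Groups*, II §7). [cite: Borel1991, II §7] -/
def hullLattice : AddSubgroup (n → ℤ) := (zdotHom s).ker

omit [DecidableEq n] in
/-- Membership in `Λ_s`. [folklore] -/
@[simp] lemma mem_hullLattice_iff (a : n → ℤ) : a ∈ hullLattice s ↔ zdot a s = 0 :=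
  (zdotHom s).mem_ker

/-- The quotient `ℤⁿ / Λ_s`, the character group of the hull torus. [folklore] -/
abbrev HullQuot : Type _ := (n → ℤ) ⧸ hullLattice s

/-- The weights `ē_j ∈ ℤⁿ / Λ_s` of the standard representation of the hull torus. [folklore] -/
def hullWt : n → HullQuot s := fun j => (QuotientAddGroup.mk (Pi.single j 1) : HullQuot s)

/-- `wtHom (hullWt s)` is the quotient map `ℤⁿ → ℤⁿ / Λ_s`. [folklore] -/
lemma wtHom_hullWt_apply (a : n → ℤ) :
    wtHom (hullWt s) a = (QuotientAddGroup.mk a : HullQuot s) := by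
  have h : (QuotientAddGroup.mk a : HullQuot s) =
      QuotientAddGroup.mk' _ (∑ i, a i • (Pi.single i (1 : ℤ) : n → ℤ)) := by
    rw [QuotientAddGroup.mk'_apply]
    congr 1
    ext j
    simp [Finset.sum_apply, Pi.single_apply]
  rw [wtHom_apply, h, map_sum]
  refine Finset.sum_congr rfl fun j _ => ?_
  rw [map_zsmul, QuotientAddGroup.mk'_apply]
  rfl

/-- The weights `hullWt s` generate `ℤⁿ / Λ_s`. [folklore] -/
lemma wtHom_hullWt_surjective : Function.Surjective (wtHom (hullWt s)) := by
  intro x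
  obtain ⟨a, rfl⟩ := QuotientAddGroup.mk_surjective x
  exact ⟨a, wtHom_hullWt_apply s a⟩

/-- The relations among the weights `hullWt s` are exactly `Λ_s`. [folklore] -/
lemma mem_ker_wtHom_hullWt_iff (a : n → ℤ) : a ∈ (wtHom (hullWt s)).ker ↔ zdot a s = 0 := by
  rw [AddMonoidHom.mem_ker, wtHom_hullWt_apply, QuotientAddGroup.eq_zero_iff, mem_hullLattice_iff]

/-- The **hull torus** `T_s = {diag(d) | d^a = 1 for all a ∈ Λ_s} ≤ 𝔻ₙ` of `diag(s)`: the weight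
torus of `ℤⁿ / Λ_s` (`WeightTorus.lean`), i.e. the intersection of the kernels of the monomial
characters `t ↦ t^a`, `⟨a, s⟩ = 0` (cf. Borel, *Linear Algebraic Groups* II §7: the group `𝒜(diag s)`,
the smallest algebraic subgroup whose Lie algebra contains `diag(s)`; here only the inclusion
`T_s ≤ G` for every algebraic `G` with `diag(s) ∈ Lie(G)` is proved, `hullTorus_le_of_diagonal_mem_lieAlgebraGL`).
[cite: Borel1991, II §7] -/
def hullTorus : Subgroup (GL n k) := weightTorus k (hullWt s)

/-- Membership in the hull torus. [folklore] -/
theorem diagonalGL_mem_hullTorus_iff (d : n → kˣ) :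
    diagonalGL n k d ∈ hullTorus s ↔ ∀ a : n → ℤ, zdot a s = 0 → ∏ j, d j ^ a j = 1 := by
  rw [hullTorus, diagonalGL_mem_weightTorus_iff (wtHom_hullWt_surjective s)]
  simp only [mem_ker_wtHom_hullWt_iff]

/-- `T_s ≤ 𝔻ₙ`. [folklore] -/
lemma hullTorus_le_diagonalSubgroup : hullTorus s ≤ diagonalSubgroup n k :=
  weightTorus_le_diagonalSubgroup

/-- In characteristic `0` the lattice `Λ_s` is saturated, i.e. `ℤⁿ / Λ_s` is torsion-free.
[folklore] -/
instance noZeroSMulDivisors_hullQuot [CharZero k] : NoZeroSMulDivisors ℤ (HullQuot s) := by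
  refine ⟨fun {c x} h => ?_⟩
  obtain ⟨a, rfl⟩ := QuotientAddGroup.mk_surjective x
  by_cases hc : c = 0
  · exact Or.inl hc
  · right
    rw [← QuotientAddGroup.mk_zsmul, QuotientAddGroup.eq_zero_iff, mem_hullLattice_iff] at h
    rw [QuotientAddGroup.eq_zero_iff, mem_hullLattice_iff]
    have h' : (c : k) * zdot a s = 0 := by
      rw [← h, zdot, zdot, Finset.mul_sum]
      refine Finset.sum_congr rfl fun i _ => ?_
      simp [mul_assoc]
    exact (mul_eq_zero.1 h').resolve_left (Int.cast_ne_zero.2 hc)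

/-- `ℤⁿ / Λ_s` is finitely generated. [folklore] -/
instance moduleFinite_hullQuot : Module.Finite ℤ (HullQuot s) :=
  Module.Finite.of_surjective ((QuotientAddGroup.mk' (hullLattice s)).toIntLinearMap)
    QuotientAddGroup.mk_surjective

/-- In characteristic `0`, `ℤⁿ / Λ_s` is free. [folklore] -/
instance moduleFree_hullQuot [CharZero k] : Module.Free ℤ (HullQuot s) :=
  Module.free_of_finite_type_torsion_free'

/-- **The hull torus is a torus** (over an algebraically closed field of characteristic `0`):
Zariski-connected, commutative, semisimple elements (`isTorusSubgroup_weightTorus`, the character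
group `ℤⁿ / Λ_s` being free). [folklore] -/
theorem isTorusSubgroup_hullTorus [IsAlgClosed k] [CharZero k] : IsTorusSubgroup (hullTorus s) :=
  isTorusSubgroup_weightTorus (wtHom_hullWt_surjective s)

/-- The characters of the hull torus detect `Λ_s`: if `d^a = 1` for all `diag(d) ∈ T_s` then
`⟨a, s⟩ = 0` (the characters of the free group `ℤⁿ / Λ_s` separate its points,
`exists_char_apply_ne_one`). [folklore] -/
theorem zdot_eq_zero_of_forall_mem_hullTorus [CharZero k] {a : n → ℤ}
    (ha : ∀ d : n → kˣ, diagonalGL n k d ∈ hullTorus s → ∏ j, d j ^ a j = 1) : zdot a s = 0 := by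
  haveI : Infinite k := Infinite.of_injective _ (Nat.cast_injective (R := k))
  by_contra h
  have hne : (QuotientAddGroup.mk a : HullQuot s) ≠ 0 := by
    rwa [Ne, QuotientAddGroup.eq_zero_iff, mem_hullLattice_iff]
  obtain ⟨χ, hχ⟩ := exists_char_apply_ne_one (k := k) hne
  apply hχ
  rw [← wtHom_hullWt_apply, apply_ofAdd_wtHom]
  exact ha _ ⟨χ, rfl⟩

end HullTorus

/-! ### Chevalley: the hull torus of a semisimple element of `Lie(G)` lies in `G` -/

section Chevalley

variable {s : n → k} {G : Subgroup (GL n k)}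

/-- The `D_{diag(s)}`-eigenvalue class function on monomials: `m ↦ ⟨w(m), s⟩`. [folklore] -/
def monClass (s : n → k) (m : GLCoord n →₀ ℕ) : k := zdot (wvec m) s

open Classical in
/-- The part of `p` supported on the monomials of class `μ` (a `Finset.filter` over the support;
classical decidability of equality in `k`). [folklore] -/
def classPart (s : n → k) (p : MvPolynomial (GLCoord n) k) (μ : k) : MvPolynomial (GLCoord n) k :=
  ∑ m ∈ p.support.filter (fun m => monClass s m = μ), monomial m (p.coeff m)

omit [DecidableEq n] in
open Classical in
/-- `p` is the sum of its class parts. [folklore] -/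
lemma sum_classPart (p : MvPolynomial (GLCoord n) k) :
    ∑ μ ∈ p.support.image (monClass s), classPart s p μ = p := by
  conv_rhs => rw [← support_sum_monomial_coeff p]
  rw [← Finset.sum_fiberwise_of_maps_to (s := p.support) (t := p.support.image (monClass s))
    (g := monClass s) fun m hm => Finset.mem_image_of_mem _ hm]
  rfl

/-- Each class part is an eigenvector of `D_{diag(s)}`. [folklore] -/
lemma rDeriv_classPart (p : MvPolynomial (GLCoord n) k) (μ : k) :
    rDeriv (Matrix.diagonal s) (classPart s p μ) = μ • classPart s p μ := by
  classical
  rw [classPart, map_sum, Finset.smul_sum]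
  refine Finset.sum_congr rfl fun m hm => ?_
  obtain ⟨-, hm2⟩ := Finset.mem_filter.1 hm
  rw [rDeriv_diagonal_monomial, sum_rDerivWeight_eq_zdot, ← monClass, hm2]

/-- Right translation by an element `diag(d)` of the hull torus multiplies each class part by a
scalar: two monomials of one class have exponents differing by an element of `Λ_s`. [folklore] -/
lemma rTransGL_classPart {d : n → kˣ} (hd : diagonalGL n k d ∈ hullTorus s)
    (p : MvPolynomial (GLCoord n) k) (μ : k) :
    ∃ c : k, rTransGL (diagonalGL n k d) (classPart s p μ) = c • classPart s p μ := by
  classical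
  by_cases hne : (p.support.filter (fun m => monClass s m = μ)).Nonempty
  · obtain ⟨m₀, hm₀⟩ := hne
    refine ⟨((∏ j, d j ^ wvec m₀ j : kˣ) : k), ?_⟩
    rw [classPart, map_sum, Finset.smul_sum]
    refine Finset.sum_congr rfl fun m hm => ?_
    rw [rTransGL_diagonalGL_monomial, prod_diagWeightGL_eq_prod_zpow]
    congr 2
    -- `w(m) - w(m₀) ∈ Λ_s`
    obtain ⟨-, hm2⟩ := Finset.mem_filter.1 hm
    obtain ⟨-, hm02⟩ := Finset.mem_filter.1 hm₀
    have hclass : zdot (wvec m - wvec m₀) s = 0 := by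
      rw [zdot_sub, ← monClass, ← monClass, hm2, hm02, sub_self]
    have h1 := (diagonalGL_mem_hullTorus_iff s d).1 hd _ hclass
    simp only [Pi.sub_apply, zpow_sub, Finset.prod_mul_distrib, Finset.prod_inv_distrib,
      mul_inv_eq_one] at h1
    exact h1
  · refine ⟨0, ?_⟩
    rw [Finset.not_nonempty_iff_eq_empty] at hne
    rw [classPart, hne, Finset.sum_empty, map_zero, smul_zero]

/-- **The class parts of an element of a `D_{diag(s)}`-stable ideal lie in the ideal**
(eigen-components for distinct eigenvalues, `mem_of_sum_eigenvector_mem`). [folklore] -/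
lemma classPart_mem_of_mem {I : Ideal (MvPolynomial (GLCoord n) k)}
    (hI : ∀ p ∈ I, rDeriv (Matrix.diagonal s) p ∈ I) {p : MvPolynomial (GLCoord n) k} (hp : p ∈ I)
    (μ : k) : classPart s p μ ∈ I := by
  classical
  by_cases hμ : μ ∈ p.support.image (monClass s)
  · have h := mem_of_sum_eigenvector_mem (rDeriv (Matrix.diagonal s)).toLinearMap
      (W := I.restrictScalars k) (fun x hx => hI x hx) (p.support.image (monClass s))
      (classPart s p) (fun μ _ => rDeriv_classPart p μ) (by rw [sum_classPart]; exact hp) μ hμ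
    exact h
  · have h0 : classPart s p μ = 0 := by
      rw [classPart]
      refine Finset.sum_eq_zero fun m hm => ?_
      obtain ⟨hm1, hm2⟩ := Finset.mem_filter.1 hm
      exact absurd (Finset.mem_image_of_mem (monClass s) hm1) (hm2 ▸ hμ)
    rw [h0]
    exact I.zero_mem

/-- **Chevalley's theorem on the algebraic hull of a semisimple element** (diagonal form): if
`G ≤ GL_n` is an algebraic subgroup and `diag(s) ∈ Lie(G)`, then the hull torus
`T_s = ⋂_{⟨a, s⟩ = 0} Ker (t ↦ t^a)` is contained in `G`. Proof: `G` is the stabiliser of its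
ideal `𝓘(G)` under right translations (`mem_of_rTransGL_vanishingIdeal`, Springer 2.3.6); `𝓘(G)`
is stable under `D_{diag(s)}` (`rDeriv_mem_idealGL`), hence spanned by its class parts
(`classPart_mem_of_mem`), on each of which `ρ(t)`, `t ∈ T_s`, is a scalar
(`rTransGL_classPart`). (Chevalley, *Théorie des groupes de Lie* II, Ch. II; Borel, *Linear
Algebraic Groups*, II §7, the groups `𝒜(M)`.) [cite: Borel1991, II §7] -/
theorem hullTorus_le_of_diagonal_mem_lieAlgebraGL (hG : IsAlgebraicSubgroup G)
    (hs : Matrix.diagonal s ∈ lieAlgebraGL G) : hullTorus s ≤ G := by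
  intro t ht
  obtain ⟨d, rfl⟩ := hullTorus_le_diagonalSubgroup s ht
  refine mem_of_rTransGL_vanishingIdeal hG fun p hp => ?_
  have hI : ∀ q ∈ idealGL G, rDeriv (Matrix.diagonal s) q ∈ idealGL G :=
    fun q hq => rDeriv_mem_idealGL hs hq
  rw [← sum_classPart (s := s) p, map_sum]
  refine Ideal.sum_mem _ fun μ _ => ?_
  obtain ⟨c, hc⟩ := rTransGL_classPart ht p μ
  rw [hc]
  exact Submodule.smul_of_tower_mem _ c (classPart_mem_of_mem hI hp μ)

end Chevalley

/-! ### Semisimple elements of `Lie(G)` centralised by a maximal torus lie in its Lie algebra -/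

section MaximalTorus

variable {G T : Subgroup (GL n k)}

omit [Fintype n] [DecidableEq n] in
/-- A subgroup of a commutative subgroup is commutative. [folklore] -/
lemma isMulCommutative_of_le {M : Type*} [Group M] {H K : Subgroup M} (hHK : H ≤ K) (hK : IsMulCommutative ↥K) :
    IsMulCommutative ↥H :=
  ⟨⟨fun a b => Subtype.ext (by
    have h := congrArg Subtype.val (hK.is_comm.comm (⟨a.1, hHK a.2⟩ : ↥K) ⟨b.1, hHK b.2⟩)
    exact h)⟩⟩

/-- **Diagonal case.** Let `G` be algebraic, `T ≤ 𝔻ₙ` a maximal torus of `G` and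
`diag(s) ∈ Lie(G)` (over an algebraically closed field of characteristic `0`). Then
`diag(s) ∈ Lie(T)`: the hull torus `T_s` lies in `G` (`hullTorus_le_of_diagonal_mem_lieAlgebraGL`)
and commutes with `T`, so `T · T_s` is a torus of `G` containing `T`, whence `T_s ≤ T` by
maximality; then every monomial character trivial on `T` is trivial on `T_s`, i.e. has exponent in
`Λ_s` (`zdot_eq_zero_of_forall_mem_hullTorus`), and `diag(s) ∈ Lie(T)` by
`diagonal_mem_lieAlgebraGL_of_forall_diagChar`. [folklore] -/
theorem diagonal_mem_lieAlgebraGL_of_isMaximalTorusIn [IsAlgClosed k] [CharZero k]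
    (hG : IsAlgebraicSubgroup G) (hT : IsMaximalTorusIn T G) (hTd : T ≤ diagonalSubgroup n k)
    {s : n → k} (hs : Matrix.diagonal s ∈ lieAlgebraGL G) : Matrix.diagonal s ∈ lieAlgebraGL T := by
  -- `T ⊔ T_s` is a torus of `G` containing `T`
  have hle : hullTorus s ≤ T := by
    set T' := T ⊔ hullTorus s with hT'
    have hT'G : T' ≤ G := sup_le hT.1 (hullTorus_le_of_diagonal_mem_lieAlgebraGL hG hs)
    have hT'd : T' ≤ diagonalSubgroup n k := sup_le hTd (hullTorus_le_diagonalSubgroup s)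
    have hT'torus : IsTorusSubgroup T' :=
      ⟨isZConnected_sup hT.2.1.1 (isTorusSubgroup_hullTorus s).1,
        isMulCommutative_of_le hT'd isMulCommutative_diagonalSubgroup,
        fun _ hg => isSemisimpleElt_of_mem_diagonalSubgroup (hT'd hg)⟩
    have h := hT.2.2 T' le_sup_left hT'G hT'torus
    exact le_sup_right.trans h.le
  refine diagonal_mem_lieAlgebraGL_of_forall_diagChar hTd fun m hm => ?_
  refine zdot_eq_zero_of_forall_mem_hullTorus s fun d hd => ?_
  have h := DFunLike.congr_fun hm ⟨diagonalGL n k d, hle hd⟩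
  rw [MonoidHom.one_apply, diagChar_apply] at h
  have hcoord : diagCoord hTd ⟨diagonalGL n k d, hle hd⟩ = d :=
    diagonalGL_injective (diagonalGL_diagCoord hTd _)
  rwa [hcoord] at h

/-- **`Lie` commutes with conjugation**: `A ∈ Lie(H)` implies `g A g⁻¹ ∈ Lie(g H g⁻¹)` (Springer
4.4.5 (ii), `Ad`; the case of an element normalising `H` is `conj_mem_lieAlgebraGL_of_forall_mem`).
[cite: SpringerLAG1998, 4.4.5 (ii)] -/
theorem conj_mem_lieAlgebraGL_map_conj {H : Subgroup (GL n k)} (g : GL n k) {A : Matrix n n k}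
    (hA : A ∈ lieAlgebraGL H) :
    (g : Matrix n n k) * A * ((g⁻¹ : GL n k) : Matrix n n k) ∈
      lieAlgebraGL (H.map (MulAut.conj g : GL n k →* GL n k)) := by
  rw [mem_lieAlgebraGL_iff_aeval] at hA ⊢
  intro p hp
  have hp' : MvPolynomial.bind₁ (conjPolyGL g g⁻¹) p ∈
      MvPolynomial.vanishingIdeal k (glCoordFun '' (H : Set (GL n k))) := by
    rw [MvPolynomial.mem_vanishingIdeal_iff] at hp ⊢
    rintro _ ⟨x, hx, rfl⟩
    rw [MvPolynomial.aeval_bind₁]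
    have hfun : (fun i => MvPolynomial.aeval (glCoordFun x) (conjPolyGL g g⁻¹ i)) =
        glCoordFun (g * x * g⁻¹) := by
      funext i
      exact eval_conjPolyGL g g⁻¹ x i
    rw [hfun]
    exact hp _ ⟨_, ⟨x, hx, rfl⟩, rfl⟩
  have h := hA _ hp'
  rw [MvPolynomial.aeval_bind₁] at h
  have hpt : (fun i => MvPolynomial.aeval (dualPoint A) (conjPolyGL g g⁻¹ i)) =
      dualPoint ((g : Matrix n n k) * A * ((g⁻¹ : GL n k) : Matrix n n k)) :=
    funext (aeval_dualPoint_conjPolyGL A g)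
  rwa [hpt] at h

/-- The subgroup generated by a commutative subgroup `T` of semisimple elements and a semisimple
element commuting with `T` is commutative and consists of semisimple elements (products of
commuting semisimple endomorphisms are semisimple, Mathlib
`Module.End.IsSemisimple.mul_of_commute`). [folklore] -/
lemma isSemisimpleElt_of_mem_closure [PerfectField k] (hTc : IsMulCommutative ↥T)
    (hTs : ∀ t ∈ T, IsSemisimpleElt t) {u : GL n k} (hu : IsSemisimpleElt u)
    (huT : ∀ t ∈ T, t * u = u * t) :
    IsMulCommutative ↥(Subgroup.closure ((T : Set (GL n k)) ∪ {u})) ∧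
      ∀ x ∈ Subgroup.closure ((T : Set (GL n k)) ∪ {u}), IsSemisimpleElt x := by
  have hcomm : ∀ x ∈ (T : Set (GL n k)) ∪ {u}, ∀ y ∈ (T : Set (GL n k)) ∪ {u}, x * y = y * x := by
    rintro x (hx | hx) y (hy | hy)
    · exact congrArg Subtype.val (hTc.is_comm.comm ⟨x, hx⟩ ⟨y, hy⟩)
    · rw [Set.mem_singleton_iff.1 hy]; exact huT x hx
    · rw [Set.mem_singleton_iff.1 hx]; exact (huT y hy).symm
    · rw [Set.mem_singleton_iff.1 hx, Set.mem_singleton_iff.1 hy]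
  have hC : IsMulCommutative ↥(Subgroup.closure ((T : Set (GL n k)) ∪ {u})) :=
    Subgroup.isMulCommutative_closure hcomm
  refine ⟨hC, fun x hx => ?_⟩
  induction hx using Subgroup.closure_induction with
  | mem x hx =>
    rcases hx with hx | hx
    · exact hTs x hx
    · rw [Set.mem_singleton_iff.1 hx]; exact hu
  | one => simp [IsSemisimpleElt, Module.End.isSemisimple_id]
  | mul x y hx hy ihx ihy =>
    have hxy : x * y = y * x := congrArg Subtype.val (hC.is_comm.comm ⟨x, hx⟩ ⟨y, hy⟩)
    have hc : Commute (Matrix.toLin' (x : Matrix n n k)) (Matrix.toLin' (y : Matrix n n k)) := by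
      change Matrix.toLin' (x : Matrix n n k) * Matrix.toLin' (y : Matrix n n k) = _
      rw [Module.End.mul_eq_comp, Module.End.mul_eq_comp, ← Matrix.toLin'_mul, ← Matrix.toLin'_mul,
        ← Units.val_mul, hxy, Units.val_mul]
    have h := Module.End.IsSemisimple.mul_of_commute hc ihx ihy
    rw [Module.End.mul_eq_comp, ← Matrix.toLin'_mul, ← Units.val_mul] at h
    exact h
  | inv x hx ihx => exact ihx.inv_of_perfectField


/-- **Simultaneous diagonalisation of a commutative group of semisimple elements and a
semisimple matrix commuting with it** (over an algebraically closed field): there is `g` with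
`g T g⁻¹ ≤ 𝔻ₙ` and `g S g⁻¹` diagonal. Proof: `S + c` is invertible for some scalar `c`
(`exists_eval_ne_zero` on the characteristic polynomial) and semisimple; apply
`exists_conj_le_diagonalSubgroup` (Springer 2.4.2 (ii)) to the commutative group of semisimple
elements generated by `T` and `S + c` (`isSemisimpleElt_of_mem_closure`). [folklore] -/
theorem exists_conj_diagonal_of_isSemisimple [IsAlgClosed k] (hTc : IsMulCommutative ↥T)
    (hTs : ∀ t ∈ T, IsSemisimpleElt t) {S : Matrix n n k}
    (hSs : Module.End.IsSemisimple (Matrix.toLin' S))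
    (hST : ∀ t ∈ T, (t : Matrix n n k) * S = S * (t : Matrix n n k)) :
    ∃ (g : GL n k) (s : n → k), T.map (MulAut.conj g : GL n k →* GL n k) ≤ diagonalSubgroup n k ∧
      (g : Matrix n n k) * S * ((g⁻¹ : GL n k) : Matrix n n k) = Matrix.diagonal s := by
  -- an invertible semisimple `u = S + c` commuting with `T`
  haveI : Infinite k := inferInstance
  obtain ⟨c, hc⟩ := (Matrix.charpoly (-S)).exists_eval_ne_zero_of_natDegree_lt_card
    (Matrix.charpoly_monic (-S)).ne_zero
    (Cardinal.natCast_lt_aleph0.trans_le (Cardinal.infinite_iff.1 ‹Infinite k›))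
  have hdet : (S + c • (1 : Matrix n n k)).det ≠ 0 := by
    rw [Matrix.eval_charpoly, Matrix.scalar_apply, ← Matrix.smul_one_eq_diagonal, sub_neg_eq_add,
      add_comm] at hc
    exact hc
  have hunit : IsUnit (S + c • (1 : Matrix n n k)) :=
    (Matrix.isUnit_iff_isUnit_det _).2 (isUnit_iff_ne_zero.2 hdet)
  set u : GL n k := hunit.unit with hu
  have hucoe : (u : Matrix n n k) = S + c • 1 := hunit.unit_spec
  have huss : IsSemisimpleElt u := by
    change Module.End.IsSemisimple (Matrix.toLin' (u : Matrix n n k))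
    have h1 : Matrix.toLin' (S + c • (1 : Matrix n n k)) =
        Matrix.toLin' S - algebraMap k (Module.End k (n → k)) (-c) := by
      rw [map_add, map_smul, Matrix.toLin'_one, map_neg, sub_neg_eq_add,
        Module.algebraMap_end_eq_smul_id]
    rw [hucoe, h1]
    exact Module.End.isSemisimple_sub_algebraMap_iff.2 hSs
  have huT : ∀ t ∈ T, t * u = u * t := by
    intro t ht
    apply Units.ext
    rw [Units.val_mul, Units.val_mul, hucoe, mul_add, add_mul, hST t ht, Matrix.mul_smul,
      Matrix.smul_mul, Matrix.mul_one, Matrix.one_mul]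
  -- simultaneous diagonalisation of `T` and `u`
  obtain ⟨hHc, hHs⟩ := isSemisimpleElt_of_mem_closure hTc hTs huss huT
  obtain ⟨g, hg⟩ := exists_conj_le_diagonalSubgroup hHc hHs
  set φ : GL n k →* GL n k := (MulAut.conj g : GL n k →* GL n k) with hφ
  have hφ' : (MulAut.conj g).toMonoidHom = φ := rfl
  rw [hφ'] at hg
  have hle : Subgroup.closure ((T : Set (GL n k)) ∪ {u}) ≤ (diagonalSubgroup n k).comap φ :=
    Subgroup.map_le_iff_le_comap.1 hg
  have hTd : T.map φ ≤ diagonalSubgroup n k := Subgroup.map_le_iff_le_comap.2 fun t ht =>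
    hle (Subgroup.subset_closure (Or.inl ht))
  have hud : φ u ∈ diagonalSubgroup n k := hle (Subgroup.subset_closure (Or.inr rfl))
  -- `g S g⁻¹` is diagonal
  obtain ⟨d, hd⟩ := hud
  refine ⟨g, fun j => (d j : k) - c, hTd, ?_⟩
  have h1 : ((φ u : GL n k) : Matrix n n k) =
      (g : Matrix n n k) * S * ((g⁻¹ : GL n k) : Matrix n n k) + c • 1 := by
    rw [hφ]
    change (((g * u * g⁻¹ : GL n k)) : Matrix n n k) = _
    rw [Units.val_mul, Units.val_mul, hucoe, Matrix.mul_add,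
      Matrix.add_mul, Matrix.mul_smul, Matrix.mul_one, Matrix.smul_mul, ← Units.val_mul,
      mul_inv_cancel, Units.val_one]
  have h2 : (g : Matrix n n k) * S * ((g⁻¹ : GL n k) : Matrix n n k) =
      ((φ u : GL n k) : Matrix n n k) - c • 1 := by
    rw [h1, add_sub_cancel_right]
  rw [h2, ← hd, coe_diagonalGL, Matrix.smul_one_eq_diagonal, Matrix.diagonal_sub]

/-- **Semisimple elements of `Lie(G)` centralised by a maximal torus `T` lie in `Lie(T)`**
(over an algebraically closed field of characteristic `0`; `G` algebraic). If `S ∈ Lie(G)` is a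
semisimple matrix commuting with every element of `T`, then `S ∈ Lie(T)`. This is the
characteristic-zero substitute for Springer 5.4.7 with 7.6.4 (ii) on the semisimple side: the
algebraic hull of `S` is a torus of `G` commuting with `T`, hence inside `T` by maximality
(Borel, *Linear Algebraic Groups*, II §7). Proof: a simultaneous diagonalisation
(`exists_conj_diagonal_of_isSemisimple`) reduces to `diagonal_mem_lieAlgebraGL_of_isMaximalTorusIn`,
transporting Lie algebras along the conjugation (`conj_mem_lieAlgebraGL_map_conj`). [folklore] -/
theorem mem_lieAlgebraGL_of_isMaximalTorusIn_of_isSemisimple [IsAlgClosed k] [CharZero k]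
    (hG : IsAlgebraicSubgroup G) (hT : IsMaximalTorusIn T G) {S : Matrix n n k}
    (hSG : S ∈ lieAlgebraGL G) (hSs : Module.End.IsSemisimple (Matrix.toLin' S))
    (hST : ∀ t ∈ T, (t : Matrix n n k) * S = S * (t : Matrix n n k)) : S ∈ lieAlgebraGL T := by
  obtain ⟨g, s, hTd, hgS⟩ := exists_conj_diagonal_of_isSemisimple hT.2.1.2.1 hT.2.1.2.2 hSs hST
  -- transport to the diagonal situation and back
  have hS' : Matrix.diagonal s ∈ lieAlgebraGL (G.map (MulAut.conj g : GL n k →* GL n k)) :=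
    hgS ▸ conj_mem_lieAlgebraGL_map_conj g hSG
  have h := diagonal_mem_lieAlgebraGL_of_isMaximalTorusIn (hG.map_conj' g) (hT.map_conj g) hTd hS'
  have h' := conj_mem_lieAlgebraGL_map_conj g⁻¹ h
  rw [map_conj_inv_map_conj, ← hgS, inv_inv] at h'
  have hS : ((g⁻¹ : GL n k) : Matrix n n k) * ((g : Matrix n n k) * S * ((g⁻¹ : GL n k) : Matrix n n k)) *
      (g : Matrix n n k) = S := by
    rw [← Matrix.mul_assoc, ← Matrix.mul_assoc, Units.inv_mul, Matrix.one_mul, Matrix.mul_assoc,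
      Units.inv_mul, Matrix.mul_one]
  rwa [hS] at h'

end MaximalTorus

end Literature.NumberTheory.Automorphic
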